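import Summits.QuantumFields.YangMills.Theorems.BalabanUVNodesN14AtRecord
import Summits.QuantumFields.YangMills.Theorems.BalabanUVNodesRateCarriersOfRecord13CoPROn

/-!
# DAG node N14 · NE1′ — THE K4 STUB `YMDAG.UVSplit.S_N14` AT THE STAGE-13 TUPLE-KEYED, REGIME-RESTRICTED RATE-RECORD HOME OF RECORD `RRec₁₃CoPROn 𝔯 Rg` (the v1.6 `CoPR`
# edition: RECORD 13 with the RUN-INDEXED residual 𝐓-weight slot `Zr` over `Stage13RParams` — director-ym №169 H1 ∕ №174 PRESS WORD ∕ №176 «v1.6 scope = Zr only»;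
# FINDING №8 = def-T LOCATED-8): the KNIT of the row from the dressing estimate at every guarded admissible tuple, its slot form (END-B by name), its dependence on
# `𝔯.ne1` ONLY, and the record census' regression test (toy ∕ doubling towers) — the TOKEN TWIN of `BalabanUVNodesN14AtRateRecord13CoPOn` (p526836; itself the `CoP`
# twin of p522273 ∕ p496675) under def-T's KEY-RULE-25 ∕ dag-lead WORDS-142 token map T₆, by ONE application each on dag-n22-e's `s_N14_rRec₁₃CoPROn_iff`

Cell `pub-ymgap`, YM-PLAN Track A (HUMAN RULING D-0062), R134 acceleration seat `pub-ymgap-dag-n14-c` (generation 8; the v1.6 CONSUMER PRESS of this lineage's ONE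
record-keyed file — director-ym №174 (3) «pens port their OWN files by token map», dag-lead DEDUP-279 (iv) ∕ DEDUP-289).  The MECHANICAL `CoPR` RE-KEY (def-T FILE 25
`Node00/Record13CoPR.lean` p529474 ✓ + FILE 26T `Node00/Record13SepCoPR.lean` p529780 ✓ — `structure Stage13RParams extends Stage13Params` with the ONE new field
`Zr : (p : B12.RunParams) → TkResidualW Fam N (FluctV N) p.K`, guard `Stage13RParams.ZrUnity`, rows `zrLaws ∕ zrLocal` in `Provisos₁₃CoPR`; RR-2's key
`Node00/Record13DatumKeyCoPR` p531309 ✓ with the guard of record RE-ISSUED over `Stage13RParams` as `Node00.unityNondeg₁₃R N` (`θ.ZrUnity F N ∧ θ.SlotsNondegenerate₁₃ F N`);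
dag-n22-e's run-indexed rate homes `BalabanUVNodesRateCarriersOfRecord13CoPR` p532576 ✓ and `BalabanUVNodesRateCarriersOfRecord13CoPROn` p533640 ✓ (INTENT-CoPR l.19614:
«decl names = your CoP citations under `CoP ↦ CoPR`»)) has LANDED, so this file is the token twin of p526836 under T₆: BINDER `(θ : Stage13Params F N) ↦ (θ : Stage13RParams F N)`
(regimes `Rg : (F : T4Family) → Stage13RParams F N → Prop`), PROVISOS `θ.Provisos₁₃Core ↦ θ.Provisos₁₃CoPR`, GUARD `θ.ZtUnity ↦ θ.ZrUnity` and `Node00.unityNondeg₁₃ N ↦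
Node00.unityNondeg₁₃R N`, STEMS `RRec₁₃CoP(On) ↦ RRec₁₃CoPR(On)`, `rRec₁₃CoP… ↦ rRec₁₃CoPR…`, `RateReading₁₃CoP ↦ RateReading₁₃CoPR`, `(Is|is)DatumOfRecord₁₃CCoP ↦ …₁₃CCoPR`,
`datumOfRecord₁₃CoP ↦ datumOfRecord₁₃CoPR`; `θ.Admissible F N` ∕ `θ.SlotsNondegenerate₁₃ F N` resolve through `extends` UNCHANGED.  THEOREMS ONLY (0 `def`, 0 `sorry`,
standard axioms); imports dag-n14-a's refinement-generic closer of record `BalabanUVNodesN14AtRecord` (p419066: `s_N14_antitone`, `n14At_of_uniformLeaves`, `n14At_toyTower`,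
`not_n14At_growing_one` — generic in `RRec`, they apply at `RRec := RRec₁₃CoPROn 𝔯 Rg` VERBATIM and are not restated) and the CoPR home (through it layer B CoPR, RR-2's key
`Node00/Record13DatumKeyCoPR`, def-T's `Node00/Record13CoPR`); modifies nothing; `--supports` K3⁶ `SpineGivenEndpointR13SepCoPR` (stmt-QuantumFields-20509, dag-lead
WORDS-142) `--as helper` — what the K3⁶ composer applies at the `CoPR` reading of a `SepCoPR` datum (FILE 26T's `rfl` bridges).  The ‴ p496675, ⁗-`Sep` p506090, `Co`
p522273 and `CoP` p526836 editions STAND as theorems at their editions (the ⁵ items are `aside` since rev 22).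

THE SITUATION AT ₁₃.  `RRec₁₃CoPROn 𝔯 Rg : RateRecordPred N` pins, at `(F, D, g₀, os)`, the bundles `rateCarriersOfRecord₁₃CoPR 𝔯 F θ hP g₀ os k` of EVERY admissible Stage-13
tuple `θ` with provisos `hP` IN THE REGIME `Rg F θ` whose datum of record is `D`, read AT `θ` (a K3⁶ composer spells the guard of record as the regime:
`Rg := Node00.unityNondeg₁₃R N`, i.e. `θ.ZrUnity F N ∧ θ.SlotsNondegenerate₁₃ F N` — the home's §4); its N14 face `s_N14_rRec₁₃CoPROn_iff` (n22-e) reads: `S_N14 (RRec₁₃CoPROn 𝔯 Rg) ↔ ∀ F θ hP, Rg F θ →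
θ.Admissible F N → ∀ g₀ os, N14At (𝔯.ne1 F θ hP g₀ os)`.  The dressed-tower assignment `𝔯.ne1` is RESIDUAL (NODE O's object); this file supplies the row's knit and
census AT THAT FACE:
* §1 **`s_N14_rRec₁₃CoPROn_of_n14At`** — THE KNIT: the dressing estimate `∀ F θ hP, Rg F θ → θ.Admissible → ∀ g₀ os, N14At (𝔯.ne1 F θ hP g₀ os)` (the s1 target type for the
  reading's assignment, guarded) gives `S_N14 (RRec₁₃CoPROn 𝔯 Rg)`; `n14At_of_s_N14_rRec₁₃CoPROn` (converse read-out at a guarded tuple); **`s_N14_rRec₁₃CoPROn_of_uniformLeaves`** ∕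
  `…_of_one` — the same from the SLOT (ONE application of `n14At_of_uniformLeaves`, END-B `dressedStabilityStrict_of_bookingLeaves` by name) resp. from ONE
  `U : UniformConstants` serving every guarded tuple.
* §2 regime glue: `s_N14_rRec₁₃CoPROn_anti` (a larger regime's stub gives a smaller one's — `k4_rRec₁₃CoPROn_anti`.1), `s_N14_rRec₁₃CoPR_of_rRec₁₃CoPROn_true` (the tuple-keyed stub at the
  trivial regime gives the CANONICAL home's `S_N14 (RRec₁₃CoPR 𝔯)`), `s_N14_rRec₁₃CoPROn_iff_of_ne1_eq` (the stub does not read `𝔯.lit`: nothing of U3 ∕ N15 ∕ N16 bears on N14 here),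
  `s_N14_rRec₁₃CoPROn_unityNondeg_of_n14At` (the knit at the v1.6 GUARD OF RECORD `Node00.unityNondeg₁₃R N` = `θ.ZrUnity F N ∧ θ.SlotsNondegenerate₁₃ F N` as the regime — an
  instance, one line; its binder prefix IS the K3 skeleton's `KeyedRates` prefix restricted to N14, cf. the home's `rateStub_rRec₁₃CoPROn_unityNondeg_iff`).
* §3 the census' regression test at ₁₃: `not_s_N14_rRec₁₃CoPROn_of_hits_growing` (a reading whose `ne1` hits the doubling tower `⟨Unit, growingTower, 1⟩` at ONE guarded
  admissible tuple has NO `S_N14`), `s_N14_rRec₁₃CoPROn_of_toy` (the constant TOY assignment closes it with no content), **`s_N14_rRec₁₃CoPROn_depends_on_ne1`** (given one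
  guarded admissible tuple with provisos, two readings with the SAME Literature-typed rate objects `lit` differ on `S_N14` — the stub is a statement ABOUT `𝔯.ne1`,
  decided by nothing in the home).

HONEST FRAMING.  Count-neutral kernel bookkeeping (one-application knits over a RESIDUAL assignment); a K3 skeleton quoting `S_N14 (RRec₁₃CoPROn 𝔯 Rg)` NAMES its `𝔯.ne1`, and
the stub is contentful exactly for `𝔯.ne1` = the dressed tower OF RECORD (absent; NODE O), junk-true for the toy assignment, false for the doubling one; unlike the ₁₁
home (`Provisos₁₁` uninhabited, def-T `not_provisos₁₁` — dag-ref-B ADDENDUM-1) the ₁₃ faces are NOT vacuous by construction (K0⁶ `Record13SepCoPRInhabited` is the open crux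
stmt-QuantumFields-20506, not refuted).  N14 NOT discharged (typed 28∕28 · discharged 5∕28 unmoved); NE1′ NOT PRINTED ([Balaban1989LargeFieldII] (1.73)–(1.75)
pp. 379–380 type the action only) and NOT PROVED; nothing of Bałaban's is asserted or denied at his objects.  One finite four-torus programme at fixed `ε` — NOT
infinite volume, NOT OS on ℝ⁴, NOT a mass gap, NOT Clay.
-/

noncomputable section

namespace YMDAG.N14

open Literature.MathematicalPhysics.QuantumFieldTheory.Balaban1983to89
open Literature.MathematicalPhysics.QuantumFieldTheory.Balaban1983to89.T4Continuum
open Summit.QuantumFields.BalabanUV.T4Continuum.NE1p.DressedRoot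
open Summit.QuantumFields.BalabanUV.T4Continuum.NE1p.DressedRootStrictSeparation
open YMDAG.UVSplit
open Node00 (Stage13RParams datumOfRecord₁₃CoPR IsDatumOfRecord₁₃CCoPR RateObjects₁₁)

variable {N : ℕ} [NeZero N] (𝔯 : RateReading₁₃CoPR N) (Rg : (F : T4Family) → Stage13RParams F N → Prop)

/-! ## §1 The knit of the row at the guarded θ-form -/

section Knit

/-- **THE KNIT OF THE ROW AT ₁₃** [bookkeeping]: the dressing estimate for the reading's dressed-tower assignment at EVERY admissible Stage-13 tuple with provisos in the
regime — `N14At (𝔯.ne1 F θ hP g₀ os)` — gives the K4 stub `S_N14 (RRec₁₃CoPROn 𝔯 Rg)` (dag-n22-e's `s_N14_rRec₁₃CoPROn_iff`, ONE application). [folklore] -/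
theorem s_N14_rRec₁₃CoPROn_of_n14At
    (h : ∀ (F : T4Family) (θ : Stage13RParams F N) (hP : θ.Provisos₁₃CoPR F N), Rg F θ → θ.Admissible F N →
      ∀ (g₀ : ℕ → ℝ) (os : List (ULoop F)), N14At (𝔯.ne1 F θ hP g₀ os)) :
    S_N14 (RRec₁₃CoPROn 𝔯 Rg) :=
  (s_N14_rRec₁₃CoPROn_iff 𝔯 Rg).mpr h

/-- **READ-OUT** [bookkeeping]: the stub at the regime-restricted home gives NE1′ for the reading's assignment at every admissible tuple with provisos in the regime. -/
theorem n14At_of_s_N14_rRec₁₃CoPROn (h : S_N14 (RRec₁₃CoPROn 𝔯 Rg)) {F : T4Family} (θ : Stage13RParams F N) (hP : θ.Provisos₁₃CoPR F N) (hRg : Rg F θ)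
    (hθ : θ.Admissible F N) (g₀ : ℕ → ℝ) (os : List (ULoop F)) : N14At (𝔯.ne1 F θ hP g₀ os) :=
  (s_N14_rRec₁₃CoPROn_iff 𝔯 Rg).mp h F θ hP hRg hθ g₀ os

/-- **THE KNIT FROM THE SLOT** [bookkeeping]: uniform leaves (END-B) for the reading's dressed tower at every guarded admissible tuple, with `U.Λ` the carriers' rate,
give `S_N14 (RRec₁₃CoPROn 𝔯 Rg)` — ONE application of dag-n14-a's `n14At_of_uniformLeaves` (`dressedStabilityStrict_of_bookingLeaves` by name). [folklore] -/
theorem s_N14_rRec₁₃CoPROn_of_uniformLeaves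
    (h : ∀ (F : T4Family) (θ : Stage13RParams F N) (hP : θ.Provisos₁₃CoPR F N), Rg F θ → θ.Admissible F N → ∀ (g₀ : ℕ → ℝ) (os : List (ULoop F)),
      ∃ U : UniformConstants, U.Λ = (𝔯.ne1 F θ hP g₀ os).Λ ∧
        ∀ p K, Nonempty (BookingLeaves U ((𝔯.ne1 F θ hP g₀ os).𝒯.B p K) ((𝔯.ne1 F θ hP g₀ os).𝒯.T p K))) :
    S_N14 (RRec₁₃CoPROn 𝔯 Rg) :=
  s_N14_rRec₁₃CoPROn_of_n14At 𝔯 Rg fun F θ hP hRg hθ g₀ os => n14At_of_uniformLeaves _ (h F θ hP hRg hθ g₀ os)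

/-- **… FROM ONE `U : UniformConstants` FOR THE WHOLE REGIME** [bookkeeping]: leaves at `U` for every guarded admissible tuple and the carriers' rates pinned into
`[0, U.Λ]` (dag-n14-a's `s_N14_of_one`, generic in the record predicate, read at `RRec₁₃CoPROn 𝔯 Rg`). [folklore] -/
theorem s_N14_rRec₁₃CoPROn_of_one (U : UniformConstants)
    (hL : ∀ (F : T4Family) (θ : Stage13RParams F N) (hP : θ.Provisos₁₃CoPR F N), Rg F θ → θ.Admissible F N → ∀ (g₀ : ℕ → ℝ) (os : List (ULoop F)),
      ∀ p K, Nonempty (BookingLeaves U ((𝔯.ne1 F θ hP g₀ os).𝒯.B p K) ((𝔯.ne1 F θ hP g₀ os).𝒯.T p K)))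
    (hΛ : ∀ (F : T4Family) (θ : Stage13RParams F N) (hP : θ.Provisos₁₃CoPR F N), Rg F θ → θ.Admissible F N → ∀ (g₀ : ℕ → ℝ) (os : List (ULoop F)),
      0 ≤ (𝔯.ne1 F θ hP g₀ os).Λ ∧ (𝔯.ne1 F θ hP g₀ os).Λ ≤ U.Λ) :
    S_N14 (RRec₁₃CoPROn 𝔯 Rg) := by
  refine s_N14_of_one (RRec₁₃CoPROn 𝔯 Rg) U (fun F D g₀ os R hR => ?_) (fun F D g₀ os R hR => ?_)
  · obtain ⟨θ, hP, hRg, hθ, -, k, rfl⟩ := hR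
    exact hL F θ hP hRg hθ g₀ os
  · obtain ⟨θ, hP, hRg, hθ, -, k, rfl⟩ := hR
    exact hΛ F θ hP hRg hθ g₀ os

end Knit

/-! ## §2 Regime glue: antitone in the regime, down to the canonical home, blind to `𝔯.lit` -/

section Glue

/-- **A LARGER REGIME'S STUB GIVES A SMALLER ONE'S** [bookkeeping] (dag-n22-e's `k4_rRec₁₃CoPROn_anti`, N14 component). [folklore] -/
theorem s_N14_rRec₁₃CoPROn_anti {Rg Rg' : (F : T4Family) → Stage13RParams F N → Prop} (h : ∀ F θ, Rg F θ → Rg' F θ) :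
    S_N14 (RRec₁₃CoPROn 𝔯 Rg') → S_N14 (RRec₁₃CoPROn 𝔯 Rg) :=
  (k4_rRec₁₃CoPROn_anti 𝔯 h).1

/-- **DOWN TO THE CANONICAL HOME** [bookkeeping]: the tuple-keyed stub at the trivial regime gives `S_N14 (RRec₁₃CoPR 𝔯)` (the canonical parameter of a datum of record is one
admissible tuple with provisos — `rRec₁₃CoPR_le_rRec₁₃CoPROn_true` + dag-n14-a's `s_N14_antitone`). [folklore] -/
theorem s_N14_rRec₁₃CoPR_of_rRec₁₃CoPROn_true (h : S_N14 (RRec₁₃CoPROn 𝔯 fun _ _ => True)) : S_N14 (RRec₁₃CoPR 𝔯) :=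
  s_N14_antitone (fun _ _ _ _ _ hR => rRec₁₃CoPR_le_rRec₁₃CoPROn_true 𝔯 hR) h

/-- **… AND TO EVERY REGIME** [bookkeeping]: the stub at the trivial regime gives the stub at any regime. [folklore] -/
theorem s_N14_rRec₁₃CoPROn_of_true (h : S_N14 (RRec₁₃CoPROn 𝔯 fun _ _ => True)) : S_N14 (RRec₁₃CoPROn 𝔯 Rg) :=
  s_N14_rRec₁₃CoPROn_anti 𝔯 (fun _ _ _ => trivial) h

/-- **THE STUB DOES NOT READ `𝔯.lit`** [bookkeeping]: two readings with the same dressed-tower assignment have the same `S_N14` at every regime — nothing of node U3 ∕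
N15 ∕ N16 (the Literature-typed rate objects) bears on N14 at the home. [folklore] -/
theorem s_N14_rRec₁₃CoPROn_iff_of_ne1_eq {𝔯 𝔯' : RateReading₁₃CoPR N}
    (h : ∀ (F : T4Family) (θ : Stage13RParams F N) (hP : θ.Provisos₁₃CoPR F N) (g₀ : ℕ → ℝ) (os : List (ULoop F)),
      𝔯.ne1 F θ hP g₀ os = 𝔯'.ne1 F θ hP g₀ os) :
    S_N14 (RRec₁₃CoPROn 𝔯 Rg) ↔ S_N14 (RRec₁₃CoPROn 𝔯' Rg) := by
  rw [s_N14_rRec₁₃CoPROn_iff, s_N14_rRec₁₃CoPROn_iff]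
  constructor
  · intro hS F θ hP hRg hθ g₀ os
    rw [← h F θ hP g₀ os]
    exact hS F θ hP hRg hθ g₀ os
  · intro hS F θ hP hRg hθ g₀ os
    rw [h F θ hP g₀ os]
    exact hS F θ hP hRg hθ g₀ os

/-- **AT THE v1.6 GUARD OF RECORD** [bookkeeping]: the K3⁶ text (stmt-QuantumFields-20509) guards the tuple by `θ.ZrUnity F N ∧ θ.SlotsNondegenerate₁₃ F N` = RR-2's
`Node00.unityNondeg₁₃R N` (`Record13DatumKeyCoPR` p531309); with that conjunction as the regime, the knit reads: the dressing estimate at every admissible tuple with provisos satisfying unity and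
slot non-degeneracy gives `S_N14 (RRec₁₃CoPROn 𝔯 (Node00.unityNondeg₁₃R N))` (one-liner on §1; the guard is spelled here only as an instance — regimes stay parameters;
the hypothesis is the N14 conjunct of the skeleton's `KeyedRates` prefix for a reading pinned to `𝔯.ne1`). [folklore] -/
theorem s_N14_rRec₁₃CoPROn_unityNondeg_of_n14At
    (h : ∀ (F : T4Family) (θ : Stage13RParams F N) (hP : θ.Provisos₁₃CoPR F N), θ.ZrUnity F N → θ.SlotsNondegenerate₁₃ F N → θ.Admissible F N →
      ∀ (g₀ : ℕ → ℝ) (os : List (ULoop F)), N14At (𝔯.ne1 F θ hP g₀ os)) :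
    S_N14 (RRec₁₃CoPROn 𝔯 (Node00.unityNondeg₁₃R N)) :=
  s_N14_rRec₁₃CoPROn_of_n14At 𝔯 _ fun F θ hP hRg hθ g₀ os => h F θ hP hRg.1 hRg.2 hθ g₀ os

end Glue

/-! ## §3 The record census' regression test at ₁₃: toy and doubling assignments -/

section Census

/-- **A READING WHOSE `ne1` HITS THE DOUBLING TOWER AT ONE GUARDED ADMISSIBLE TUPLE HAS NO `S_N14`** [decided probe]: `⟨Unit, growingTower, 1⟩` fails NE1′
(dag-n14-a's `not_n14At_growing_one`). [folklore] -/
theorem not_s_N14_rRec₁₃CoPROn_of_hits_growing {F : T4Family} (θ : Stage13RParams F N) (hP : θ.Provisos₁₃CoPR F N) (hRg : Rg F θ) (hθ : θ.Admissible F N)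
    (g₀ : ℕ → ℝ) (os : List (ULoop F)) (h : 𝔯.ne1 F θ hP g₀ os = ⟨Unit, growingTower, 1⟩) : ¬ S_N14 (RRec₁₃CoPROn 𝔯 Rg) := by
  intro hS
  have h14 := n14At_of_s_N14_rRec₁₃CoPROn 𝔯 Rg hS θ hP hRg hθ g₀ os
  rw [h] at h14
  exact not_n14At_growing_one h14

/-- **THE CONSTANT TOY ASSIGNMENT CLOSES THE STUB WITH NO CONTENT** [decided probe]: `⟨Unit, toyTower, 2⟩` satisfies NE1′ (dag-n14-a's `n14At_toyTower`). [folklore] -/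
theorem s_N14_rRec₁₃CoPROn_of_toy
    (h : ∀ (F : T4Family) (θ : Stage13RParams F N) (hP : θ.Provisos₁₃CoPR F N) (g₀ : ℕ → ℝ) (os : List (ULoop F)),
      𝔯.ne1 F θ hP g₀ os = ⟨Unit, toyTower, 2⟩) :
    S_N14 (RRec₁₃CoPROn 𝔯 Rg) :=
  s_N14_rRec₁₃CoPROn_of_n14At 𝔯 Rg fun F θ hP _ _ g₀ os => by rw [h F θ hP g₀ os]; exact n14At_toyTower

/-- **THE STUB IS A STATEMENT ABOUT `𝔯.ne1`, DECIDED BY NOTHING IN THE HOME** [decided probe]: given ONE admissible tuple with provisos in the regime (for some family),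
there are two readings with the SAME Literature-typed rate objects `lit`, one with `S_N14` and one without. [folklore] -/
theorem s_N14_rRec₁₃CoPROn_depends_on_ne1 (lit : (F : T4Family) → (θ : Stage13RParams F N) → θ.Provisos₁₃CoPR F N → (ℕ → ℝ) → List (ULoop F) → RateObjects₁₁ N)
    (hinh : ∃ (F : T4Family) (θ : Stage13RParams F N) (_ : θ.Provisos₁₃CoPR F N), Rg F θ ∧ θ.Admissible F N) :
    ∃ 𝔯₁ 𝔯₂ : RateReading₁₃CoPR N, 𝔯₁.lit = lit ∧ 𝔯₂.lit = lit ∧ S_N14 (RRec₁₃CoPROn 𝔯₁ Rg) ∧ ¬ S_N14 (RRec₁₃CoPROn 𝔯₂ Rg) := by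
  obtain ⟨F, θ, hP, hRg, hθ⟩ := hinh
  refine ⟨⟨lit, fun _ _ _ _ _ => ⟨Unit, toyTower, 2⟩⟩, ⟨lit, fun _ _ _ _ _ => ⟨Unit, growingTower, 1⟩⟩, rfl, rfl,
    s_N14_rRec₁₃CoPROn_of_toy _ Rg (fun _ _ _ _ _ => rfl), ?_⟩
  exact not_s_N14_rRec₁₃CoPROn_of_hits_growing _ Rg θ hP hRg hθ (fun _ => 0) [] rfl

end Census

end YMDAG.N14

end
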